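import Summits.CriticalPhenomena.SAWScalingLimit.Theorems.SAWTotalPositivityTPToTraversalBoundMultiDiveAux

/-!
# Nested optional stopping `UnforcedDiveBound → MultiDiveBound` — stub `multiDiveBound_of_unforcedDiveBound`

Line `exit-mass-unforced-dive` of the crux `SAWTotalPositivity.TPToTraversalBound`
(stmt-CriticalPhenomena-10687); registered stub `stub_multiDive_of_unforced`, landing name
`multiDiveBound_of_unforcedDiveBound` (vocabulary `DiveSet`, `ChargedSet`, `TravSeq`, `Targets`,
`UnforcedDiveBound`, `MultiDiveBound` in `…TPToTraversalBoundDiveDefs.lean`; the clock-independent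
infrastructure is `…TPToTraversalBoundMultiDiveAux.lean`).

STATEMENT.  `UnforcedDiveBound` (Kemppainen–Smirnov's Condition G2/G3 for the critical SAW: after every
self-avoiding lattice prefix `η`, the chords whose future EVER dives — traverses an admissible annulus
`A(z₀, r, R)`, `δ ≤ r`, `C₀ r ≤ R`, landing in `Targets η` — weigh at most `ε · W(PrefixSet η)`)
implies
`MultiDiveBound` with the SAME `C₀(ε), δ₀(ε)`: `p` charges judged at the canonical clock-traversal times
`E (mj 0) < E (mj 1) < ⋯` (the `k`-th one a dive of an admissible annulus after the prefix stopped at its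
judging time, completed before the next judging time) weigh at most `ε ^ p · W(PrefixSet η)`.

PROOF (nested optional stopping for a purely atomic measure: `W = SAW.weight Ω δ a b` is a sum of weighted
Dirac masses on the discrete σ-algebra, so only countable (sub)additivity and monotonicity are used).  By
induction on `p`, for every prefix `η`, every clock length `n` and all admissible charge data
(`weight_chargedSet_le_pow`, over an abstract admissibility predicate `Adm` and cost `c`):
* `p = 0`: a charged chord extends `η` (`chargedSet_subset_prefixSet`).
* `p = 1` (`weight_chargedSet_one_le`): the STOPPED FAMILY at level `T = mj 0` — the prefixes
  `η' = η ++ q.take (E T)` of the charged chords; each is a path whose piece after `η` has its level-`T`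
  canonical time at its very end.  Canonical times are PREFIX-DETERMINED and UNIQUE (`travSeq_take_iff`,
  `TravSeq.unique`), so two such prefixes with a common extension coincide: the sets `PrefixSet η'` are
  pairwise disjoint (`pairwiseDisjoint_prefixSet_stopped`) and contained in `PrefixSet η`.  A charged chord
  extending `η'` lies in `DiveSet η'` by definition, hence `W(charged) ≤ Σ_{η'} W(DiveSet η')`, which is
  `≤ c · Σ_{η'} W(PrefixSet η') = c · W(⋃_{η'} PrefixSet η') ≤ c · W(PrefixSet η)`
  (`measure_le_mul_measure_biUnion`).
* `p + 2`: stop at the SECOND judging level `T₁ = mj 1`, `η₁ = η ++ q.take (E T₁)`.  RE-BASING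
  (`chargedSet_subset_rebase`): the chord carries the remaining `p + 1` charges after `η₁` along the
  re-based clock (`TravSeq.drop`: levels shifted by `T₁`, times by `E T₁`), and its first charge —
  completed by time `E T₁` — is a property of `η₁` alone (prefix determination).  By induction each `η₁`
  contributes `≤ c ^ (p + 1) · W(PrefixSet η₁)`; by disjointness these contributions add up to
  `c ^ (p + 1) · W(⋃ PrefixSet η₁)`, and the union lies in the ONE-charge event judged along the clock up
  to level `T₁`
  (`biUnion_prefixSet_subset_chargedSet_one`: the canonical times of `ρ ++ q` agree with those of `ρ` up to
  level `T₁`), of weight `≤ c · W(PrefixSet η)` by the case `p = 1`.  Total `c ^ (p + 2)`.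
The clock hypotheses `δ ≤ rc`, `C₀ rc ≤ Rc` of `MultiDiveBound` are not needed.

Sources: A. Kemppainen, S. Smirnov, *Random curves, scaling limits and Loewner evolutions*, Ann. Probab.
45 (2017) 698–779 = arXiv:1212.6215, §2.2 (Conditions G2, G3) and §3.2 (proof of Prop. 3.5: nested
stopping at crossing times); N. Madras, G. Slade, *The Self-Avoiding Walk* (1993), §1.2 (SAW weights,
prefixes).  No definitions and no named facts.
-/

noncomputable section

open MeasureTheory Set
open scoped ENNReal
open Literature.Probability.LatticeModels
open Literature.Probability.RandomPlanarGeometry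
open Summit.CriticalPhenomena.SAWScalingLimit.Theses.SAWTotalPositivity
open Summit.CriticalPhenomena.SAWScalingLimit.Theorems.TPToTraversalBound.Negative (PrefixSet)

namespace Summit.CriticalPhenomena.SAWScalingLimit.Theorems.TPToTraversalBound.ExitMass

variable {Ω : Set ℂ} {δ : ℝ} {z₀ : ℂ} {rc Rc : ℝ} {a₀ b₀ : Site 2}

/-- Strictly increasing steps below `p` make `mj` monotone on `[0, p)`. [folklore] -/
theorem mj_mono_of_succ_lt {mj : ℕ → ℕ} {p : ℕ} (hmj : ∀ k, k + 1 < p → mj k < mj (k + 1)) :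
    ∀ {k k' : ℕ}, k ≤ k' → k' < p → mj k ≤ mj k' := by
  intro k k' hkk'
  induction hkk' with
  | refl => exact fun _ => le_rfl
  | @step l _ ih => exact fun hl => (ih (by omega)).trans (hmj l (by omega)).le

/-! ## One charge: the stopped family at the judging level -/

/-- **ONE.**  A single charge judged at the canonical clock time `E (mj 0)` costs `c`: condition on the
stopped prefix `η' = η ++ q.take (E (mj 0))` (a path, stopped at level `mj 0`); the charge is a dive of
`A(z₀, rch 0, Rch 0)` after `η'` landing in `Targets η'`, so the charged chords extending `η'` lie in
`DiveSet η'`, of weight `≤ c · W(PrefixSet η')` by the dive hypothesis; the stopped prefixes have pairwise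
disjoint extension sets contained in `PrefixSet η` (optional stopping). [folklore] -/
theorem weight_chargedSet_one_le {Adm : ℝ → ℝ → Prop} {c : ℝ≥0∞}
    (hdive : ∀ r R, Adm r R → ∀ (v : Site 2) (η : (discreteDomainGraph Ω δ).Walk a₀ v), η.IsPath →
      SAW.weight Ω δ a₀ b₀ (DiveSet Ω δ z₀ r R η b₀) ≤
        c * SAW.weight Ω δ a₀ b₀ (PrefixSet Ω δ a₀ b₀ η))
    {v : Site 2} (η : (discreteDomainGraph Ω δ).Walk a₀ v) (n : ℕ) (mj : ℕ → ℕ) (rch Rch : ℕ → ℝ)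
    (h0 : Adm (rch 0) (Rch 0)) :
    SAW.weight Ω δ a₀ b₀ (ChargedSet Ω δ z₀ rc Rc η b₀ n 1 mj rch Rch) ≤
      c * SAW.weight Ω δ a₀ b₀ (PrefixSet Ω δ a₀ b₀ η) := by
  haveI := fun v' => countable_walk (G := discreteDomainGraph Ω δ) a₀ v'
  refine (measure_le_mul_measure_biUnion (SAW.weight Ω δ a₀ b₀)
    (F := {σ : Σ v', (discreteDomainGraph Ω δ).Walk a₀ v' | σ.2.IsPath ∧
      ∃ (v' : Site 2) (ρ : (discreteDomainGraph Ω δ).Walk v v'), σ = ⟨v', η.append ρ⟩ ∧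
        ∃ E : ℕ → ℕ, TravSeq δ z₀ rc Rc ρ (mj 0) E ∧ E (mj 0) = ρ.length})
    (A := fun σ => DiveSet Ω δ z₀ (rch 0) (Rch 0) σ.2 b₀) (B := fun σ => PrefixSet Ω δ a₀ b₀ σ.2)
    ?_ (fun σ hσ => hdive _ _ h0 σ.1 σ.2 hσ.1) ?_ fun _ _ => MeasurableSpace.measurableSet_top).trans ?_
  · -- the charged chords are covered by the dive events of the stopped prefixes
    rintro γ ⟨q, E, hq, hE, hk⟩
    obtain ⟨hT, i, j, htr, htg, -⟩ := hk 0 one_pos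
    have hsplit : γ.walk = (η.append (q.take (E (mj 0)))).append (q.drop (E (mj 0))) := by
      rw [← SimpleGraph.Walk.append_assoc, SimpleGraph.Walk.append_take_drop_eq]; exact hq
    refine Set.mem_iUnion₂.2 ⟨⟨_, η.append (q.take (E (mj 0)))⟩, ⟨?_, _, _, rfl, E, ?_, ?_⟩, ?_⟩
    · have hp := γ.isPath
      rw [hsplit] at hp
      exact hp.of_append_left
    · exact (travSeq_take_iff q _ _ E).2 ⟨hE.of_le hT, le_rfl⟩
    · rw [SimpleGraph.Walk.take_length]; exact (inf_eq_left.2 (hE.le_length hT)).symm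
    · exact ⟨q.drop (E (mj 0)), hsplit, i, j, htr, htg⟩
  · -- the stopped family is an antichain
    exact (pairwiseDisjoint_prefixSet_stopped (z₀ := z₀) (r := rc) (R := Rc) b₀ η (mj 0)).subset
      fun σ hσ => hσ.2
  · -- every stopped prefix extends `η`
    gcongr
    refine Set.iUnion₂_subset fun σ hσ => ?_
    obtain ⟨-, v', ρ, rfl, -⟩ := hσ
    exact prefixSet_append_subset b₀ η ρ

/-! ## Several charges: re-basing at the second judging time -/

/-- **Re-basing.**  A chord with `p + 1 ≥ 2` charged windows after `η`, conditioned on its stopped prefix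
`η₁ = η ++ q.take (E (mj 1))` at the SECOND judging level: (a) `η₁` is a path stopped at level `mj 1`
whose own canonical times already exhibit the first charge (a dive of the `0`-th charged annulus after level
`mj 0`, completed by level `mj 1` — prefix determination), and (b) the chord has the remaining `p` charged
windows after `η₁`, along the re-based clock (levels shifted by `mj 1`, canonical times by `E (mj 1)`).
[folklore] -/
theorem chargedSet_subset_rebase {v : Site 2} (η : (discreteDomainGraph Ω δ).Walk a₀ v) (n p : ℕ)
    (mj : ℕ → ℕ) (rch Rch : ℕ → ℝ) (hp : 0 < p) (hmj : ∀ k, k + 1 < p + 1 → mj k < mj (k + 1)) :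
    ChargedSet Ω δ z₀ rc Rc η b₀ n (p + 1) mj rch Rch ⊆
      ⋃ σ ∈ {σ : Σ v', (discreteDomainGraph Ω δ).Walk a₀ v' | σ.2.IsPath ∧
          ∃ (v' : Site 2) (ρ : (discreteDomainGraph Ω δ).Walk v v'), σ = ⟨v', η.append ρ⟩ ∧
            ∃ E : ℕ → ℕ, TravSeq δ z₀ rc Rc ρ (mj 1) E ∧ E (mj 1) = ρ.length ∧
              ∃ i j, IsTraversal δ z₀ (rch 0) (Rch 0) (ρ.drop (E (mj 0))) i j ∧
                (ρ.drop (E (mj 0))).getVert j ∈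
                  Targets Ω δ z₀ (rch 0) (Rch 0) (η.append (ρ.take (E (mj 0)))) b₀ ∧
                E (mj 0) + j ≤ E (mj 1)},
        ChargedSet Ω δ z₀ rc Rc σ.2 b₀ (n - mj 1) p (fun k => mj (k + 1) - mj 1)
          (fun k => rch (k + 1)) (fun k => Rch (k + 1)) := by
  rintro γ ⟨q, E, hq, hE, hk⟩
  have hmono : ∀ {k k' : ℕ}, k ≤ k' → k' < p + 1 → mj k ≤ mj k' := mj_mono_of_succ_lt hmj
  obtain ⟨hT₁n, -⟩ := hk 1 (by omega)
  obtain ⟨-, i₀, j₀, htr₀, htg₀, hwin₀⟩ := hk 0 (by omega)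
  have hwin₀ : E (mj 0) + j₀ ≤ E (mj 1) := hwin₀ (by omega)
  have ht₁q : E (mj 1) ≤ q.length := hE.le_length hT₁n
  have h01 : E (mj 0) ≤ E (mj 1) := hE.monotone (hmj 0 (by omega)).le hT₁n
  have hsplit : γ.walk = (η.append (q.take (E (mj 1)))).append (q.drop (E (mj 1))) := by
    rw [← SimpleGraph.Walk.append_assoc, SimpleGraph.Walk.append_take_drop_eq]; exact hq
  refine Set.mem_iUnion₂.2
    ⟨⟨_, η.append (q.take (E (mj 1)))⟩, ⟨?_, _, _, rfl, E, ?_, ?_, i₀, j₀, ?_, ?_, hwin₀⟩, ?_⟩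
  · have hp' := γ.isPath
    rw [hsplit] at hp'
    exact hp'.of_append_left
  · exact (travSeq_take_iff q _ _ E).2 ⟨hE.of_le hT₁n, le_rfl⟩
  · rw [SimpleGraph.Walk.take_length]; exact (inf_eq_left.2 ht₁q).symm
  · -- the first charge is a traversal inside the stopped prefix (prefix determination)
    rw [isTraversal_drop_iff, isTraversal_take_iff, ← isTraversal_drop_iff]
    exact ⟨htr₀, hwin₀⟩
  · -- … landing in the targets judged at level `mj 0`
    have key : Targets Ω δ z₀ (rch 0) (Rch 0) (η.append ((q.take (E (mj 1))).take (E (mj 0)))) b₀ =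
        Targets Ω δ z₀ (rch 0) (Rch 0) (η.append (q.take (E (mj 0)))) b₀ :=
      targets_congr b₀ _ _ (by rw [SimpleGraph.Walk.take_getVert, inf_eq_right.2 h01])
        (by rw [SimpleGraph.Walk.support_append, SimpleGraph.Walk.support_append,
          support_take_take_of_le q h01])
    rw [key, SimpleGraph.Walk.drop_getVert, SimpleGraph.Walk.take_getVert, inf_eq_right.2 hwin₀]
    rw [SimpleGraph.Walk.drop_getVert] at htg₀
    exact htg₀
  · -- the remaining `p` charges, re-based at `η₁`
    refine ⟨q.drop (E (mj 1)), fun m => E (m + mj 1) - E (mj 1), hsplit, hE.drop hT₁n,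
      fun k hkp => ?_⟩
    obtain ⟨hkn, i, j, htr, htg, hwin⟩ := hk (k + 1) (by omega)
    have h1k : mj 1 ≤ mj (k + 1) := hmono (by omega) (by omega)
    have hEk : E (mj 1) ≤ E (mj (k + 1)) := hE.monotone h1k hkn
    dsimp only
    rw [Nat.sub_add_cancel h1k]
    refine ⟨by omega, i, j, ?_, ?_, fun hk1 => ?_⟩
    · rw [isTraversal_drop_iff, isTraversal_drop_iff]
      rw [isTraversal_drop_iff] at htr
      have e1 : E (mj 1) + (E (mj (k + 1)) - E (mj 1) + i) = E (mj (k + 1)) + i := by omega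
      have e2 : E (mj 1) + (E (mj (k + 1)) - E (mj 1) + j) = E (mj (k + 1)) + j := by omega
      rw [e1, e2]
      exact htr
    · have key : Targets Ω δ z₀ (rch (k + 1)) (Rch (k + 1)) ((η.append (q.take (E (mj 1)))).append
            ((q.drop (E (mj 1))).take (E (mj (k + 1)) - E (mj 1)))) b₀ =
          Targets Ω δ z₀ (rch (k + 1)) (Rch (k + 1)) (η.append (q.take (E (mj (k + 1))))) b₀ :=
        targets_congr b₀ _ _ (by rw [SimpleGraph.Walk.drop_getVert, Nat.add_sub_cancel' hEk])
          (by rw [← support_append_take_add, Nat.add_sub_cancel' hEk])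
      rw [key, SimpleGraph.Walk.drop_getVert, SimpleGraph.Walk.drop_getVert, ← Nat.add_assoc,
        Nat.add_sub_cancel' hEk]
      rw [SimpleGraph.Walk.drop_getVert] at htg
      exact htg
    · have hw := hwin (by omega)
      have h1k' : mj 1 ≤ mj (k + 1 + 1) := hmono (by omega) (by omega)
      rw [Nat.sub_add_cancel h1k']
      omega

/-- **The first charge is decided by the stopped prefix.**  Every chord extending a stopped prefix
`η ++ ρ` at level `mj 1` whose canonical times exhibit the first charge inside `ρ` has one charged window
after `η` along the clock run up to level `mj 1` (canonical times of `ρ ++ q` agree with those of `ρ` up to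
level `mj 1`). [folklore] -/
theorem biUnion_prefixSet_subset_chargedSet_one {v : Site 2} (η : (discreteDomainGraph Ω δ).Walk a₀ v)
    (mj : ℕ → ℕ) (rch Rch : ℕ → ℝ) (h01 : mj 0 ≤ mj 1) :
    (⋃ σ ∈ {σ : Σ v', (discreteDomainGraph Ω δ).Walk a₀ v' | σ.2.IsPath ∧
          ∃ (v' : Site 2) (ρ : (discreteDomainGraph Ω δ).Walk v v'), σ = ⟨v', η.append ρ⟩ ∧
            ∃ E : ℕ → ℕ, TravSeq δ z₀ rc Rc ρ (mj 1) E ∧ E (mj 1) = ρ.length ∧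
              ∃ i j, IsTraversal δ z₀ (rch 0) (Rch 0) (ρ.drop (E (mj 0))) i j ∧
                (ρ.drop (E (mj 0))).getVert j ∈
                  Targets Ω δ z₀ (rch 0) (Rch 0) (η.append (ρ.take (E (mj 0)))) b₀ ∧
                E (mj 0) + j ≤ E (mj 1)},
        PrefixSet Ω δ a₀ b₀ σ.2) ⊆ ChargedSet Ω δ z₀ rc Rc η b₀ (mj 1) 1 mj rch Rch := by
  intro γ hγ
  obtain ⟨σ, hσ, hγσ⟩ := Set.mem_iUnion₂.1 hγ
  obtain ⟨-, v', ρ, rfl, E, hE, hEl, i, j, htr, htg, hwin⟩ := hσ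
  obtain ⟨q, hq⟩ := hγσ
  dsimp only at q hq
  have hjl : E (mj 0) + j ≤ ρ.length := hwin.trans hEl.le
  refine ⟨ρ.append q, E, by rw [hq, SimpleGraph.Walk.append_assoc],
    ((travSeq_append_iff ρ q _ E).1 hE).1, fun k hk => ?_⟩
  obtain rfl : k = 0 := Nat.lt_one_iff.1 hk
  refine ⟨h01, i, j, ?_, ?_, fun h => absurd h (by omega)⟩
  · rw [isTraversal_drop_iff] at htr ⊢
    exact ((isTraversal_append_left_iff ρ q _ _).1 htr).1
  · have key : Targets Ω δ z₀ (rch 0) (Rch 0) (η.append ((ρ.append q).take (E (mj 0)))) b₀ =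
        Targets Ω δ z₀ (rch 0) (Rch 0) (η.append (ρ.take (E (mj 0)))) b₀ :=
      targets_congr b₀ _ _ (getVert_append_of_le ρ q (by omega))
        (by rw [SimpleGraph.Walk.support_append, SimpleGraph.Walk.support_append,
          support_take_append_of_le ρ q (by omega)])
    rw [key, SimpleGraph.Walk.drop_getVert, getVert_append_of_le ρ q hjl]
    rw [SimpleGraph.Walk.drop_getVert] at htg
    exact htg

/-! ## The induction on the number of charges -/

/-- **`p` charged windows cost `c ^ p`** (induction on `p`; `W = SAW.weight`, conditioning = restriction to
`PrefixSet`).  `p = 0`: a charged chord extends `η`.  `p = 1`: `weight_chargedSet_one_le`.  `p + 2`: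
re-base at the stopped prefix `η₁` of the second judging level (`chargedSet_subset_rebase`); by induction
the remaining `p + 1` charges cost `c ^ (p + 1) · W(PrefixSet η₁)` for each `η₁`; the `η₁` form an
antichain, so these weights add up to the weight of a union which, the first charge being decided by `η₁`
(`biUnion_prefixSet_subset_chargedSet_one`), lies in the one-charge event judged along the clock up to level
`mj 1`, of weight `≤ c · W(PrefixSet η)`. [folklore] -/
theorem weight_chargedSet_le_pow {Adm : ℝ → ℝ → Prop} {c : ℝ≥0∞}
    (hdive : ∀ r R, Adm r R → ∀ (v : Site 2) (η : (discreteDomainGraph Ω δ).Walk a₀ v), η.IsPath →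
      SAW.weight Ω δ a₀ b₀ (DiveSet Ω δ z₀ r R η b₀) ≤
        c * SAW.weight Ω δ a₀ b₀ (PrefixSet Ω δ a₀ b₀ η)) (p : ℕ) :
    ∀ {v : Site 2} (η : (discreteDomainGraph Ω δ).Walk a₀ v), η.IsPath →
      ∀ (n : ℕ) (mj : ℕ → ℕ) (rch Rch : ℕ → ℝ), (∀ k, k + 1 < p → mj k < mj (k + 1)) →
        (∀ k, k < p → Adm (rch k) (Rch k)) →
        SAW.weight Ω δ a₀ b₀ (ChargedSet Ω δ z₀ rc Rc η b₀ n p mj rch Rch) ≤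
          c ^ p * SAW.weight Ω δ a₀ b₀ (PrefixSet Ω δ a₀ b₀ η) := by
  induction p with
  | zero =>
    intro v η _ n mj rch Rch _ _
    rw [pow_zero, one_mul]
    exact measure_mono (chargedSet_subset_prefixSet Ω δ z₀ rc Rc η b₀ n 0 mj rch Rch)
  | succ p ih =>
    intro v η _ n mj rch Rch hmj hadm
    rcases p with _ | p
    · -- one charge
      rw [zero_add, pow_one]
      exact weight_chargedSet_one_le hdive η n mj rch Rch (hadm 0 (by omega))
    -- `p + 2` charges: re-base at the second judging level
    haveI := fun v' => countable_walk (G := discreteDomainGraph Ω δ) a₀ v'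
    have hmono : ∀ {k k' : ℕ}, k ≤ k' → k' < p + 1 + 1 → mj k ≤ mj k' := mj_mono_of_succ_lt hmj
    refine (measure_le_mul_measure_biUnion (SAW.weight Ω δ a₀ b₀) (c := c ^ (p + 1))
      (B := fun σ => PrefixSet Ω δ a₀ b₀ σ.2)
      (chargedSet_subset_rebase (b₀ := b₀) η n (p + 1) mj rch Rch (Nat.succ_pos p) hmj)
      (fun σ hσ => ?_) ?_ fun _ _ => MeasurableSpace.measurableSet_top).trans ?_
    · -- induction hypothesis at each stopped prefix
      refine ih σ.2 hσ.1 _ _ _ _ (fun k hk => ?_) fun k hk => hadm (k + 1) (by omega)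
      have h1 := hmj (k + 1) (by omega)
      have h2 : mj 1 ≤ mj (k + 1) := hmono (by omega) (by omega)
      omega
    · -- the stopped family is an antichain
      exact (pairwiseDisjoint_prefixSet_stopped (z₀ := z₀) (r := rc) (R := Rc) b₀ η (mj 1)).subset
        fun σ hσ => by
          obtain ⟨-, v', ρ, h, E, hE, hEl, -⟩ := hσ
          exact ⟨v', ρ, h, E, hE, hEl⟩
    · -- the union of the good stopped prefixes is a one-charge event, judged up to level `mj 1`
      have hD := biUnion_prefixSet_subset_chargedSet_one (z₀ := z₀) (rc := rc) (Rc := Rc) (b₀ := b₀)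
        η mj rch Rch (hmj 0 (by omega)).le
      have h1 := weight_chargedSet_one_le (rc := rc) (Rc := Rc) hdive η (mj 1) mj rch Rch
        (hadm 0 (by omega))
      calc _ ≤ c ^ (p + 1) * (c * SAW.weight Ω δ a₀ b₀ (PrefixSet Ω δ a₀ b₀ η)) := by
            gcongr
            exact (measure_mono hD).trans h1
        _ = c ^ (p + 1 + 1) * SAW.weight Ω δ a₀ b₀ (PrefixSet Ω δ a₀ b₀ η) := by ring

/-! ## The registered stub -/

/-- **Stub `multiDiveBound_of_unforcedDiveBound` (registered `stub_multiDive_of_unforced`) — nested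
optional stopping, Kemppainen–Smirnov "G2 ⇒ G3": `UnforcedDiveBound → MultiDiveBound`** with the SAME
`C₀(ε), δ₀(ε)`.  `p` charges judged at successive canonical clock-traversal times cost `ε ^ p`: apply
`weight_chargedSet_le_pow` with the admissibility predicate `δ ≤ r ∧ C₀ r ≤ R` and the dive hypothesis
supplied by `UnforcedDiveBound` (the clock hypotheses `δ ≤ rc`, `C₀ rc ≤ Rc` are not needed).
[folklore] -/
theorem multiDiveBound_of_unforcedDiveBound : UnforcedDiveBound → MultiDiveBound := by
  intro hU D a b hab ε hε
  obtain ⟨C₀, δ₀, hC₀, hδ₀, h⟩ := hU D a b hab ε hε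
  refine ⟨C₀, δ₀, hC₀, hδ₀, fun δ hδ z₀ rc Rc _ _ v η hη n p mj rch Rch hmj hch => ?_⟩
  exact weight_chargedSet_le_pow (Adm := fun r R => δ ≤ r ∧ C₀ * r ≤ R)
    (fun r R hrR v' η' hη' => h δ hδ z₀ r R hrR.1 hrR.2 v' η' hη') p η hη n mj rch Rch hmj hch

end Summit.CriticalPhenomena.SAWScalingLimit.Theorems.TPToTraversalBound.ExitMass

end
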